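import Mathlib
import HarnessLib
import Literature.Analysis.FluidPDE.TypeIAncientMild
import Literature.Analysis.FluidPDE.VorticityCalculus
import Literature.Analysis.FluidPDE.TaoEnstrophyLocalisationProofs
import Summits.NavierStokesRegularity.NavierStokesRegularity.Theses.IsobarTomography
import Summits.NavierStokesRegularity.NavierStokesRegularity.Theorems.IsobarTomographyBlobRiccatiClosureStubLimsupTimes
import Summits.NavierStokesRegularity.NavierStokesRegularity.Theorems.IsobarTomographyBlobRiccatiClosureStubArgmaxSlice
import Summits.NavierStokesRegularity.NavierStokesRegularity.Theorems.IsobarTomographyBlobRiccatiClosureStubHessianCentreLimit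
import Summits.NavierStokesRegularity.NavierStokesRegularity.Theorems.IsobarTomographyBlobRiccatiClosureApexZoomTools
import Summits.NavierStokesRegularity.NavierStokesRegularity.Theorems.IsobarTomographyBlobRiccatiClosureApexZoomBundle
import Summits.NavierStokesRegularity.NavierStokesRegularity.Theorems.IsobarTomographyBlobRiccatiClosureApexZoom

/-!
# Skeleton — line `type-i-apex-liouville` for crux `IsobarTomography.BlobRiccatiClosure`
(stmt-NavierStokesRegularity-11740; crux-strategist planner-cstrat-stmt-NavierStokesRegularity-11740-p1-0,
2026-08-17; wall-breaker on the exhausted chain: lines `Sketch` dead at S6 ⇔ crux, six ideas failed triage;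
lead c2 prover-line-stmt-NavierStokesRegularity-11740-c2-0, 2026-08-17: stub B reshaped into the
registered tools B1 `stub_limsupTimes`, B2 `stub_hessianCentreLimit`, B3 `stub_argmaxSlice`, B4 `stub_hessianApplyLimit`, B5 `stub_windowTomographyBundle` + the
assembly B `stub_apexZoom` (fixed zoom time `σ = −limsup g`); stubs A, C unchanged.
STATUS 2026-08-17 (lead c2, end of cycle 1): B1 p137630, B3 p137643, B4 p137909, B2 p138068, B5 p138442
and B `stub_apexZoom` p139136 LANDED under `Theorems/IsobarTomographyBlobRiccatiClosure{StubLimsupTimes,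
StubArgmaxSlice,ApexZoomTools,StubHessianCentreLimit,ApexZoomBundle,ApexZoom}.lean`; the stubs below are now
ALIASES of the landed theorems (no sorry). Also landed in C's currency: `stub_apexStretching` /
`stub_apexStretchingSharp` (Theorems/…ApexStretching.lean p138870/p139037: at an apex
`1/(−σ) + |∇ω|²_F ≤ α`). OPEN: A = `NoTypeII` (item stmt-0056, by name) and C = `stub_apexAntiBlob`
(open-problem class, ≤ stmt-4050); the composition `BlobRiccatiClosure_of` is the crux modulo A, C, and the
discharged glue `NoTypeII → C → K1` is `Theorems.….stub_cruxOfApexAntiBlob` (Theorems/…TypeIApexGlue.lean).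
STATUS 2026-08-17 (lead c3, prover-line-stmt-NavierStokesRegularity-11740-c3-0, cycle 1): same line, stubs
A, C unchanged (C re-confirmed open-problem class; no local mechanism — door argument). Landed in C's
currency: APEX STRUCTURE IV, the SCALE FLOOR (`stub_apexScaleFloor`, `apexScaleFloor_and_gradient_ratio`,
Theorems/…ApexScaleFloor.lean p143692): for every Type-I constant `C` there are `ε(C) > 0`, `K(C)` with `ε ≤ −σ`
and `‖∇W(σ)(0)‖ ≤ (K/ε)‖curl W(σ,0)‖` at EVERY apex — apexes are not arbitrarily strain-dominated (the
qualitative, class-uniform form of C's first conjunct `|S|² ≤ ½‖ω‖²`); its engine is a new Liouville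
theorem, `stub_smallScaledVorticityLiouville` (Type-I ancient mild + `(−t)‖curl W‖ ≤ ε(C)` ⇒ `W ≡ 0`,
Theorems/…SmallScaledVorticityLiouville.lean p142767) proved through a local div–curl tomography of `∇W`
(Theorems/…DivCurlGradientBound.lean p142174, …DivCurlTools.lean p141645, with the tools …HolderHalfTools p141175,
…CutoffTools p141270, …BiotSavartSmooth p141165, …LocalHarmonic p141082, …StubCurlSmul p140857,
…TypeIGaugeBounds p141212) feeding the proved `SmallStrainRung`. Landed on the NEGATIVE side: N1
`stub_falseWithoutFiniteEnergy` and `n1_falseWithoutLerayHopf` (Theorems/…FalseWithoutFiniteEnergy.lean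
p141106): K1 is FALSE with the finite-energy hypotheses (resp. with ONLY `IsLerayHopfOn`) deleted — every
line must consume Leray–Hopf; this one does, in B.)

The crux K1: a finite-energy (Leray–Hopf) classical solution `(u, p)` of unforced Navier–Stokes on
`ℝ³ × [0, T)` from a rapidly decaying datum which satisfies the BLOB HYPOTHESIS — some `κ > 0`,
threshold `Ω(t)` and `t₀ < T` such that for `t ∈ [t₀, T)` the peak set `{‖ω(t,·)‖ > Ω(t)}` is
non-empty and on it `κ ‖ω‖² Δp ≤ D²p[ω, ω]` — extends classically past `T`.

## The line (Type-I re-base + extremal-apex zoom + apex Liouville residual)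

Every seat of the opening chain certified that no argument local to the vorticity argmax can
close K1 (S6 ⇔ crux; tilting `σ²`, viscous 2-jet `V`, argmax relay `R` unsigned; N1: K1 is FALSE
without finite energy, by blob-tight linear flows `u = A(t)x`; N2: no same-time depletion; N3: the
Type-I-free zoom class is inhabited for every `κ`). Finite energy can only act scale-invariantly,
i.e. through the Type-I habitat, and the route's `closes` already derives `IsTypeIBlowup` from its
own item `NoTypeII` BEFORE it uses K1. This line therefore composes the crux from

* `stub_noTypeII` (A) — the route's shared item stmt-NavierStokesRegularity-0056 BY NAME
  (`Theses.IsobarTomography.NoTypeII`, rank 5 here, rank 2 on TypeILiouville; 22 routes want it).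
  It is NOT to be worked on this line: `closes` discharges it before the blob branch; it appears
  here only because the typed crux carries no rate hypothesis.
* `stub_apexZoom` (B, provable, L) — THE EXTREMAL-APEX ZOOM. For a maximal Type-I solution
  satisfying blob(κ, Ω, t₀): the scale-invariant vorticity `g(t) = (T − t)‖ω(t)‖_∞` lies in
  `[c, C]` near `T` (LANDED `TubeAlternative.AnalyticPropagation.stub_twoSidedVorticityRate`,
  p114767: KNSS smoothing for the upper bound, zoom-at-bad-times + ESS backward uniqueness for the
  lower one); pick `t_k → T` with `g(t_k) → G := limsup g` and `x_k` a GLOBAL ARGMAX of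
  `‖ω(t_k, ·)‖` (attained: slab decay, landed `Sketch.stub_uniformDecay` p106818); `x_k` lies in the
  peak set (non-emptiness clause: `Ω(t_k) < ‖ω(t_k, x)‖ ≤ ‖ω(t_k, x_k)‖` for some `x`), so blob
  holds at `(t_k, x_k)`. Zoom at the vorticity scale exactly as in the LANDED
  `TubeAlternative.AnalyticPropagation.stub_peakZoomPatch` (p118794):
  `w_k(s, y) = c_k u(T + c_k²ν s, x_k + c_k ν y)`, `c_k²ν = 1/‖ω(t_k, x_k)‖`, so that
  `(−s)‖curl w_k(s, y)‖ = (T − t)‖ω(t, x)‖ ≤ g(t)` identically and the peak sits at zoom time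
  `s₀(k) = −g(t_k) → −G =: σ ∈ [−C, −c]`; KNSS compactness (`exists_tendsto_of_typeI_seq_Ioo`) gives
  a Type-I ancient mild limit `W` (`IsTypeIAncientMild C₁ W`) with one classical pressure on
  `(−∞, 0)` (`exists_isClassicalNSSolutionOn_Iio_of_isTypeIAncientMild`), `‖curl W(σ, 0)‖ = 1`
  (time-Lipschitz gradient bounds, as in p118794) and, pointwise in the limit,
  `(−s)‖curl W(s, y)‖ ≤ G = −σ` for ALL `s < 0`: the point `(σ, 0)` is a global SPACE–TIME
  maximiser of the scale-invariant vorticity of `W` (an "apex"). The blob inequality is homogeneous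
  of degree 8 in the zoom factor and closed; `Δq_k = ‖curl w_k‖² − |∇w_k|²_F` converges with the
  gradients; the one new analytic input is the convergence of the pressure Hessian AT THE CENTRE,
  `D²q_k(s₀(k), 0) → D²q(σ, 0)`, and the tree already holds the pointwise tool for it:
  `Theorems.exists_hessian_tomography_bound` (SqueezeCycle, PayerTomographyHessian, LANDED) — for a
  bounded smooth divergence-free field with bounded gradient and ANY classical pressure `q`
  (`Δq = −div((u·∇)u)`, `‖∇q‖ ≤ B`),
  `|D²q(x)(e,e) + G(x)/3 + ∫_{|z|<R} D²Γ(z)(e,e)(G(x−z) − G(x)) dz| ≤ c₀(MM₁/R + M²/R² + B/R)`,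
  `G = div((u·∇)u)`; the zoomed fields and the limit satisfy its hypotheses with k-UNIFORM constants
  (`M, M₁`: Type-I bound and `exists_norm_iteratedFDeriv_le_of_typeI_Ioo`; `B`: `∇q = Δw − (w·∇)w −
  ∂ₛw` with the time-Lipschitz bound `exists_lipschitz_time_of_typeI_Ioo`; `G`, `∇G`: `C³` bounds),
  so the near integral passes to the limit by dominated convergence (local uniform convergence of
  `G_k`, integrand `≲ |z|⁻²` on the ball) and `R → ∞` removes the error: no pressure representation,
  no Calderón–Zygmund theory is needed.
* `stub_apexAntiBlob` (C, THE BET, open-problem class) — APEX LIOUVILLE: at an apex `(σ, 0)` of a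
  Type-I ancient mild field (global space–time maximiser of `(−s)‖curl W‖`, normalised to
  `‖curl W(σ,0)‖ = 1`) the blob inequality FAILS for every `κ > 0`; equivalently (letting `κ → 0`
  and `κ → ∞`) every apex is vorticity-dominated-or-marginal (`Δq ≥ 0`) and axially
  pressure-NON-convex (`D²q[ξ, ξ] ≤ 0`, strictly if `Δq = 0`) — "Type-I apexes are stretched
  columns, never squeezed blobs" — OR there is no Type-I ancient mild field at all. It is implied
  by the programme's Type-I Liouville node `ExtremalTypeIConstant.TypeIAncientLiouville`
  (stmt-NavierStokesRegularity-4050, hence by SqueezeLiouville / RecurrentLiouville stmt-1589 and by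
  (L) stmt-10661): `apexAntiBlob_of_typeIAncientLiouville` below, PROVED. What the apex adds to
  4050: the Danskin conditions of a two-sided space–time maximum of `(−s)‖curl W‖`
  (`∂_s log‖ω‖ = 1/(−s)`: growth at exactly the self-similar rate; `∇‖ω‖ = 0`, `D²‖ω‖² ≤ 0`, the
  second-order time condition) AND the sign of one entry of the non-local pressure Hessian against
  its trace at that point.

Composition `BlobRiccatiClosure_of`: not extendable ⇒ maximal ⇒ Type I (A) ⇒ apex profile with
blob at the apex (B) ⇒ contradiction with (C).

Dead line avoided: `Sketch` integrated the GGH Riccati law at the moving argmax (door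
`Ṁ ≤ 2α(x⋆)M`, S6 ⇔ crux). This line integrates nothing in time and evaluates no `D_tα`: `σ²`,
`V`, `R` are not terms of any inequality here; the price is Type I, paid by the route's own item.
Disproof used: no `Disproof.lean` exists for this crux (`ledger crux ls`, 2026-08-17); the line
honours the would-be `BlobRiccatiClosure_false_without_LerayHopf_and_Decay` (IDEATION-r2-k4 N1,
TRIAGE-r2-1/2: verified) — `IsLerayHopfOn ∧ HasRapidSpatialDecay` are consumed by (B) (attained
maxima, Leray points, mildness of the zoom) and by (A).
-/

noncomputable section

open MeasureTheory Set Function Filter Topology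
open scoped ENNReal NNReal InnerProductSpace RealInnerProductSpace

-- the summit and its single sub-problem share the name (CONVENTIONS §1)
set_option linter.dupNamespace false

namespace Summit.NavierStokesRegularity.NavierStokesRegularity.Cruxes.BlobRiccatiClosure.TypeIApexLiouville

open Literature.Analysis Literature.Analysis.FluidPDE
open Summit.NavierStokesRegularity.NavierStokesRegularity.Theses

local notation "E³" => EuclideanSpace ℝ (Fin 3)

/-! ### Stub A — the route's shared item `NoTypeII` (stmt-NavierStokesRegularity-0056), by name -/

/-- **A, `NoTypeII` (= route item stmt-NavierStokesRegularity-0056, shared by 22 routes; staffed on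
route TypeILiouville at rank 2).** A maximal finite-energy classical solution from a rapidly
decaying datum with finite lifespan blows up at the Type-I rate. NOT a working stub of this line:
the route's deciding theorem `closes` derives it before the blob branch (`have hI := hII … hmax`),
so for the ROUTE the re-base of K1 on Type I is free; it is registered here only because the typed
crux has no rate hypothesis. -/
theorem stub_noTypeII : IsobarTomography.NoTypeII := by
  sorry

/-! ### Tools for stub B — registered helper stubs B1–B3 (lead c2 reshape, 2026-08-17)

The proof of `stub_apexZoom` (B) is assembled in
`Theorems/IsobarTomographyBlobRiccatiClosureApexZoom.lean` from the zoom kit of the tree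
(`zoom_isClassical`, `zoom_oseen`, `zoom_norm_le`, `exists_tendsto_of_typeI_seq_Ioo`,
`exists_isClassicalNSSolutionOn_Iio_of_isTypeIAncientMild`, window bounds
`exists_norm_iteratedFDeriv_le_of_typeI_Ioo` / `exists_lipschitz_time_of_typeI_Ioo`) and three
self-contained tools registered here so that they can be landed separately (`--supports`):
B1 the limsup times of a bounded gauge function, B2 the convergence of the pressure Hessian at a
point under pointwise convergence of the velocity gradients with uniform tomography constants
(`exists_hessian_tomography_bound`), B3 the attained vorticity maximum of a slice. They are not
terms of `BlobRiccatiClosure_of` (B is); the skeleton's composition is unchanged. -/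

/-- **B1, LIMSUP TIMES (real analysis).** A function `m` with `c ≤ m ≤ C` on `[t₂, T)` has a
value `G ∈ [c, C]` (its `limsup` at `T⁻`) which is the limit of `m` along some sequence
`t_k → T`, `t_k ∈ [t₂, T)`, and which bounds `m` from above near `T` up to every `ε > 0`.
Used with `m(t) = (T − t) sup_x ‖ω(t, x)‖` (two-sided vorticity rate p114767) to place the zoom
times at the EXTREMAL level `G`, so that the limit's scale-invariant vorticity is globally
maximised at the marked point. [folklore] -/
theorem stub_limsupTimes :
    ∀ (m : ℝ → ℝ) (c C t₂ T : ℝ), t₂ < T → (∀ t ∈ Ico t₂ T, c ≤ m t ∧ m t ≤ C) →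
      ∃ G : ℝ, c ≤ G ∧ G ≤ C ∧
        (∃ tk : ℕ → ℝ, (∀ k, tk k ∈ Ico t₂ T) ∧ Tendsto tk atTop (𝓝 T) ∧
          Tendsto (fun k => m (tk k)) atTop (𝓝 G)) ∧
        ∀ ε : ℝ, 0 < ε → ∃ T' : ℝ, T' < T ∧ ∀ t ∈ Ioo T' T, m t ≤ G + ε :=
  _root_.Summit.NavierStokesRegularity.NavierStokesRegularity.Theorems.BlobRiccatiClosure.TypeIApexLiouville.stub_limsupTimes

/-- **B2, CONVERGENCE OF THE PRESSURE HESSIAN AT A POINT (tomography).** Let `(v_j, q_j)` be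
`C⁴` divergence-free fields with Poisson pressures `Δq_j = −div((v_j·∇)v_j)` obeying, eventually
in `j`, the uniform bounds `|v_j| ≤ M`, `‖∇v_j‖ ≤ M₁`, `‖∇q_j‖ ≤ B`, `|G_j| ≤ S`, `‖∇G_j‖ ≤ L`
(`G_j = div((v_j·∇)v_j) = tr(∇v_j)²`), and let `(V, Q)` satisfy the same. If `∇v_j → ∇V`
pointwise, then `D²q_j(x)(e,e) → D²Q(x)(e,e)` for every `x`, `e`. Proof: the landed pointwise
tomography `exists_hessian_tomography_bound` (SqueezeCycle PayerTomographyHessian) gives, for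
unit `e` and every `R > 0`, `D²q(x)(e,e) = −G(x)/3 − ∫_{|z|<R} D²Γ(z)(e,e)(G(x−z) − G(x))dz + O(1/R)`
with the SAME `O(1/R)` for all `j` and for the limit; `G_j → G` pointwise (continuity of
`A ↦ tr A²`), the ball integral converges by dominated convergence (integrand
`≤ ‖D²Γ(z)‖ L|z| ≲ L|z|⁻²`, integrable on a ball of `ℝ³`), and `R → ∞` kills the remainder;
general `e` by homogeneity. [cite: GilbargTrudinger2001, Lemma 4.2 (4.9)–(4.10)] -/
theorem stub_hessianCentreLimit :
    ∀ (v : ℕ → E³ → E³) (q : ℕ → E³ → ℝ) (V : E³ → E³) (Q : E³ → ℝ) (M M₁ B S L : ℝ)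
      (x e : E³),
      (∀ᶠ j in atTop, ContDiff ℝ 4 (v j) ∧ VectorCalculus.IsDivFree (v j) ∧ ContDiff ℝ 4 (q j) ∧
        (∀ y, ‖v j y‖ ≤ M) ∧ (∀ y, ‖fderiv ℝ (v j) y‖ ≤ M₁) ∧
        (∀ y, Laplacian.laplacian (q j) y = -VectorCalculus.divergence (convect (v j) (v j)) y) ∧
        (∀ y, ‖fderiv ℝ (q j) y‖ ≤ B) ∧
        (∀ y, ‖VectorCalculus.divergence (convect (v j) (v j)) y‖ ≤ S) ∧
        (∀ y, ‖fderiv ℝ (VectorCalculus.divergence (convect (v j) (v j))) y‖ ≤ L)) →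
      ContDiff ℝ 4 V → VectorCalculus.IsDivFree V → ContDiff ℝ 4 Q →
      (∀ y, ‖V y‖ ≤ M) → (∀ y, ‖fderiv ℝ V y‖ ≤ M₁) →
      (∀ y, Laplacian.laplacian Q y = -VectorCalculus.divergence (convect V V) y) →
      (∀ y, ‖fderiv ℝ Q y‖ ≤ B) →
      (∀ y, ‖VectorCalculus.divergence (convect V V) y‖ ≤ S) →
      (∀ y, ‖fderiv ℝ (VectorCalculus.divergence (convect V V)) y‖ ≤ L) →
      (∀ y, Tendsto (fun j => fderiv ℝ (v j) y) atTop (𝓝 (fderiv ℝ V y))) →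
      Tendsto (fun j => fderiv ℝ (fderiv ℝ (q j)) x e e) atTop
        (𝓝 (fderiv ℝ (fderiv ℝ Q) x e e)) :=
  _root_.Summit.NavierStokesRegularity.NavierStokesRegularity.Theorems.BlobRiccatiClosure.TypeIApexLiouville.stub_hessianCentreLimit

/-- **B3, THE VORTICITY MAXIMUM OF A SLICE IS ATTAINED.** For a classical solution on `[0, T)`,
Leray–Hopf from a rapidly decaying datum, at every time `t < T` at which the vorticity does not
vanish identically, `x ↦ ‖ω(t, x)‖` attains its maximum (uniform spatial decay of `‖ω‖²` on the
closed slab `[0, t]`, landed `Sketch.stub_uniformDecay` p106818, + continuity: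
`Sketch.supGronwall_sliceMax` p107630). The argmax lies in every non-empty superlevel set
`{‖ω(t,·)‖ > Ω(t)}`, which is how the blob hypothesis is consumed at the zoom centres. [folklore] -/
theorem stub_argmaxSlice :
    ∀ (ν T : ℝ) (u : ℝ → E³ → E³) (p : ℝ → E³ → ℝ), 0 < ν → 0 < T →
      IsClassicalNSSolutionOn (Ico 0 T) ν 0 u p → IsLerayHopfOn T ν 0 (u 0) u →
      HasRapidSpatialDecay (u 0) →
      ∀ t ∈ Ico 0 T, (∃ x : E³, 0 < ‖curl (u t) x‖) →
        ∃ x₀ : E³, ∀ y : E³, ‖curl (u t) y‖ ≤ ‖curl (u t) x₀‖ :=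
  _root_.Summit.NavierStokesRegularity.NavierStokesRegularity.Theorems.BlobRiccatiClosure.TypeIApexLiouville.stub_argmaxSlice

/-- **B4, LIMIT OF A QUADRATIC FORM UNDER DIAGONAL CONVERGENCE (linear algebra on `ℝ³`).** If
symmetric bilinear forms `H_j` converge to a symmetric form `H` on the diagonal
(`H_j(e,e) → H(e,e)` for every `e`) and `ω_j → ω`, then `H_j(ω_j, ω_j) → H(ω, ω)` (polarisation
⇒ entrywise convergence; expand `ω_j` in the standard basis). This is how the diagonal values
delivered by B2 are consumed at the moving vorticity vectors `ω_j = curl w_j(σ,0) → curl W(σ,0)`;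
it anchors the tools file `Theorems/IsobarTomographyBlobRiccatiClosureApexZoomTools.lean`
(zoom-centre scaling of `curl`, `Δq`, `D²q`; scale-exactness of the blob inequality). [folklore] -/
theorem stub_hessianApplyLimit :
    ∀ (H : ℕ → EuclideanSpace ℝ (Fin 3) →L[ℝ] EuclideanSpace ℝ (Fin 3) →L[ℝ] ℝ) (Hlim : EuclideanSpace ℝ (Fin 3) →L[ℝ] EuclideanSpace ℝ (Fin 3) →L[ℝ] ℝ) (ω : ℕ → EuclideanSpace ℝ (Fin 3)) (ωlim : EuclideanSpace ℝ (Fin 3)),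
      (∀ j v w, H j v w = H j w v) → (∀ v w, Hlim v w = Hlim w v) →
      (∀ e, Tendsto (fun j => H j e e) atTop (𝓝 (Hlim e e))) →
      Tendsto ω atTop (𝓝 ωlim) →
      Tendsto (fun j => H j (ω j) (ω j)) atTop (𝓝 (Hlim ωlim ωlim)) :=
  _root_.Summit.NavierStokesRegularity.NavierStokesRegularity.Theorems.BlobRiccatiClosure.TypeIApexLiouville.stub_hessianApplyLimit

/-- **B5, THE TOMOGRAPHY BUNDLE AT A WINDOW TIME.** For a classical unit-viscosity pair `(w, q)`
on a window `(A, 0)` and a time `σ` of the window, bounds on the spatial derivatives of orders `≤ 3`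
of `w(σ)` and on `∂ₛw(σ, ·)` yield the hypotheses of B2 at `σ` (`C⁴`, divergence free, Poisson
pressure, `‖∇q(σ)‖ ≤ 3K₂ + K₁K₀ + L`, source bounds); anchors the tools file
`Theorems/IsobarTomographyBlobRiccatiClosureApexZoomBundle.lean`. [folklore] -/
theorem stub_windowTomographyBundle :
    ∀ (A σ K₀ K₁ K₂ K₃ L : ℝ) (w : ℝ → EuclideanSpace ℝ (Fin 3) → EuclideanSpace ℝ (Fin 3)) (q : ℝ → EuclideanSpace ℝ (Fin 3) → ℝ),
      IsClassicalNSSolutionOn (Ioo A 0) 1 0 w q → σ ∈ Ioo A 0 →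
      (∀ y, ‖w σ y‖ ≤ K₀) → (∀ y, ‖fderiv ℝ (w σ) y‖ ≤ K₁) →
      (∀ y, ‖iteratedFDeriv ℝ 2 (w σ) y‖ ≤ K₂) → (∀ y, ‖iteratedFDeriv ℝ 3 (w σ) y‖ ≤ K₃) →
      (∀ y, ‖deriv (fun s => w s y) σ‖ ≤ L) →
      ContDiff ℝ 4 (w σ) ∧ VectorCalculus.IsDivFree (w σ) ∧ ContDiff ℝ 4 (q σ) ∧
      (∀ y, Laplacian.laplacian (q σ) y = -VectorCalculus.divergence (convect (w σ) (w σ)) y) ∧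
      (∀ y, ‖fderiv ℝ (q σ) y‖ ≤ 3 * K₂ + K₁ * K₀ + L) ∧
      (∀ y, ‖VectorCalculus.divergence (convect (w σ) (w σ)) y‖ ≤
        ‖(traceCLM : (EuclideanSpace ℝ (Fin 3) →L[ℝ] EuclideanSpace ℝ (Fin 3)) →L[ℝ] ℝ)‖ *
          ((1 + ‖(traceCLM : (EuclideanSpace ℝ (Fin 3) →L[ℝ] EuclideanSpace ℝ (Fin 3)) →L[ℝ] ℝ)‖) *
            (2 ^ (0 + 1) * (max (max (max K₀ K₁) (max K₂ K₃)) 0) ^ 2))) ∧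
      (∀ y, ‖fderiv ℝ (VectorCalculus.divergence (convect (w σ) (w σ))) y‖ ≤
        ‖(traceCLM : (EuclideanSpace ℝ (Fin 3) →L[ℝ] EuclideanSpace ℝ (Fin 3)) →L[ℝ] ℝ)‖ *
          ((1 + ‖(traceCLM : (EuclideanSpace ℝ (Fin 3) →L[ℝ] EuclideanSpace ℝ (Fin 3)) →L[ℝ] ℝ)‖) *
            (2 ^ (1 + 1) * (max (max (max K₀ K₁) (max K₂ K₃)) 0) ^ 2))) :=
  _root_.Summit.NavierStokesRegularity.NavierStokesRegularity.Theorems.BlobRiccatiClosure.TypeIApexLiouville.stub_windowTomographyBundle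

/-! ### Stub B — the extremal-apex zoom under Type I (provable from the tree, size L) -/

/-- **B, EXTREMAL-APEX ZOOM.** Let `(u, p)` be a maximal classical solution on `[0, T)`,
Leray–Hopf from its rapidly decaying datum, blowing up at the Type-I rate, and satisfying the blob
hypothesis with `(κ, Ω, t₀)`. Then there is a Type-I ancient mild field `W` (Oseen/KNSS gauge,
`IsTypeIAncientMild C W`) with a classical pressure `q` on `(−∞, 0)` and a time `σ < 0` such that
`‖curl W(σ, 0)‖ = 1`, the point `(σ, 0)` maximises the scale-invariant vorticity over the whole
slab, `(−s)‖curl W(s, y)‖ ≤ −σ` for all `s < 0`, `y`, and the blob inequality holds at `(σ, 0)`: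
`κ ‖curl W(σ,0)‖² Δq(σ, 0) ≤ D²q(σ, 0)[curl W(σ,0), curl W(σ,0)]`.
Proof route (module docstring): two-sided vorticity rate (landed p114767) ⇒
`g(t) = (T − t)‖ω(t)‖_∞ ∈ [c, C]`; times `t_k → T` with `g(t_k) → limsup g`, global argmaxes `x_k`
(in the peak set by the non-emptiness clause); vorticity-scale zoom at `(t_k, x_k)` as in the landed
`stub_peakZoomPatch` (p118794), for which `(−s)‖curl w_k(s,y)‖ = (T − t)‖ω(t,x)‖`; KNSS compactness;
blob passes to the limit at the centre by scale invariance, `Δq = ‖ω‖² − |∇w|²_F`, and convergence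
of the normalised pressure Hessian at the centre (far field `O(R⁻²)`, near field by local `C²`
convergence). [KNSS 2009 = arXiv:0709.3599 Prop. 4.1, Lemma 6.1; Seregin 2014 Notes Prop. 3.11,
pp. 109–114; Giga–Miura 2011 / Giga–Hsu–Maekawa arXiv:1310.6471 §4 (Type-I blow-up argument)] -/
theorem stub_apexZoom :
    ∀ (ν T : ℝ), 0 < ν → 0 < T → ∀ (u : ℝ → EuclideanSpace ℝ (Fin 3) → EuclideanSpace ℝ (Fin 3)) (p : ℝ → EuclideanSpace ℝ (Fin 3) → ℝ),
      IsMaximalSmoothSolution ν 0 u p T → IsLerayHopfOn T ν 0 (u 0) u →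
      HasRapidSpatialDecay (u 0) → IsTypeIBlowup u T →
      ∀ (κ : ℝ) (Ω : ℝ → ℝ) (t₀ : ℝ), 0 < κ → t₀ ∈ Ico 0 T →
      (∀ t ∈ Ico t₀ T, (∃ x : EuclideanSpace ℝ (Fin 3), Ω t < ‖curl (u t) x‖) ∧
        ∀ x : EuclideanSpace ℝ (Fin 3), Ω t < ‖curl (u t) x‖ →
          κ * ‖curl (u t) x‖ ^ 2 * Laplacian.laplacian (p t) x ≤
            iteratedFDeriv ℝ 2 (p t) x ![curl (u t) x, curl (u t) x]) →
      ∃ (C : ℝ) (W : ℝ → EuclideanSpace ℝ (Fin 3) → EuclideanSpace ℝ (Fin 3)) (q : ℝ → EuclideanSpace ℝ (Fin 3) → ℝ) (σ : ℝ),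
        IsTypeIAncientMild C W ∧ IsClassicalNSSolutionOn (Iio 0) 1 0 W q ∧ σ < 0 ∧
        ‖curl (W σ) 0‖ = 1 ∧ (∀ s < 0, ∀ y : EuclideanSpace ℝ (Fin 3), (-s) * ‖curl (W s) y‖ ≤ -σ) ∧
        κ * ‖curl (W σ) 0‖ ^ 2 * Laplacian.laplacian (q σ) 0 ≤
          iteratedFDeriv ℝ 2 (q σ) 0 ![curl (W σ) 0, curl (W σ) 0] :=
  _root_.Summit.NavierStokesRegularity.NavierStokesRegularity.Theorems.BlobRiccatiClosure.TypeIApexLiouville.stub_apexZoom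

/-! ### Stub C — THE BET: apex Liouville (Type-I apexes are anti-blob) -/

/-- **C, APEX ANTI-BLOB (the bet; open-problem class, ≤ stmt-4050 `TypeIAncientLiouville`).** For
every `κ > 0`: if `W` is a Type-I ancient mild field with classical pressure `q` on `(−∞, 0)` and
`(σ, 0)`, `σ < 0`, is an apex — `‖curl W(σ, 0)‖ = 1` and `(−s)‖curl W(s, y)‖ ≤ −σ` on the whole
slab — then the blob inequality fails there:
`D²q(σ,0)[curl W(σ,0), curl W(σ,0)] < κ ‖curl W(σ,0)‖² Δq(σ, 0)`. For all `κ` at once this says: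
at every apex `Δq ≥ 0` (vorticity-dominated or marginal, `Δq = ‖ω‖² − |∇W|²_F = ½‖ω‖² − |S|²`) and
`D²q[ξ, ξ] ≤ 0` (pressure axially non-convex along the vorticity), strictly when `Δq = 0` — or no
Type-I ancient mild field exists. What is known (2026-08-17, lead c3): the APEX SCALE FLOOR — for every
`C` there are `ε(C) > 0`, `K(C)` with `ε ≤ −σ` and `‖∇W(σ)(0)‖ ≤ K/ε` at every apex of the class
(`Theorems.….stub_apexScaleFloor`, `apexScaleFloor_and_gradient_ratio`, p143692; any attack on C may assume them:
the small-`G` / infinitely-strain-dominated regime is empty); beyond that, nothing at an apex beyond the Danskin conditions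
(`∂_s‖ω‖ = ‖ω‖/(−s)`, `∇‖ω‖ = 0`, `D²‖ω‖² ≤ 0`, second-order time condition, which bound `D²q[ξ,ξ]`
from BELOW only — IDEATION-r2-k4 §5); the class is killed wholesale by 4050 / SqueezeLiouville /
RecurrentLiouville (stmt-1589) / (L); symmetric members (2D, axisymmetric) and self-similar members
are already excluded in tree (KNSS Thms 5.1–5.3, NRŠ–Tsai). A refutation is ONE Type-I ancient mild
field with a blob apex (Bradshaw–Tsai OP 5.1 territory: a λ-DSS profile would be the candidate).
[arXiv:0709.3599 §1, §5; Seregin 2014 Notes p. 113 (Conjecture); BradshawTsai2017 OP 5.1] -/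
theorem stub_apexAntiBlob :
    ∀ κ : ℝ, 0 < κ → ∀ (C : ℝ) (W : ℝ → E³ → E³) (q : ℝ → E³ → ℝ) (σ : ℝ),
      IsTypeIAncientMild C W → IsClassicalNSSolutionOn (Iio 0) 1 0 W q → σ < 0 →
      ‖curl (W σ) 0‖ = 1 → (∀ s < 0, ∀ y : E³, (-s) * ‖curl (W s) y‖ ≤ -σ) →
      iteratedFDeriv ℝ 2 (q σ) 0 ![curl (W σ) 0, curl (W σ) 0] <
        κ * ‖curl (W σ) 0‖ ^ 2 * Laplacian.laplacian (q σ) 0 := by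
  sorry

/-! ### Calibration (proved): the residual C sits below the programme's Type-I Liouville node -/

/-- `TypeIAncientLiouville` (route ExtremalTypeIConstant / SymmetryModuliCount target,
stmt-NavierStokesRegularity-4050, verbatim signature): every Type-I ancient mild field in the KNSS
gauge vanishes identically. Recorded here as a `def` only to state the calibration lemma below. -/
def TypeIAncientLiouvilleSig : Prop :=
  ∀ (C : ℝ) (u : ℝ → EuclideanSpace ℝ (Fin 3) → EuclideanSpace ℝ (Fin 3)),
    ContDiffOn ℝ (⊤ : ℕ∞) (Function.uncurry u) (Set.Iio 0 ×ˢ Set.univ) ∧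
    (∀ t < 0, Literature.Analysis.FluidPDE.VectorCalculus.IsDivFree (u t)) ∧
    (∀ s t : ℝ, s < t → t < 0 → ∀ x, u t x =
      Literature.Analysis.FluidPDE.heatFlow (u s) (t - s) x -
        ∫ τ in Set.Ioo s t, ∫ y, Literature.Analysis.FluidPDE.oseenKernel (t - τ) (x - y) (u τ y) (u τ y)) ∧
    Literature.Analysis.FluidPDE.HasTypeITimeDecay C u → ∀ t < 0, ∀ x, u t x = 0

/-- **Calibration (PROVED): stmt-4050 ⇒ stub C.** If every Type-I ancient mild field vanishes, no
apex exists (`‖curl W(σ,0)‖ = 1` is impossible for `W(σ, ·) ≡ 0`), so C holds vacuously. Hence the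
residual of this line is at most as hard as the programme's central Type-I Liouville node (and a
fortiori than SqueezeLiouville, RecurrentLiouville stmt-1589, or (L) stmt-10661). -/
theorem apexAntiBlob_of_typeIAncientLiouville (hL : TypeIAncientLiouvilleSig) :
    ∀ κ : ℝ, 0 < κ → ∀ (C : ℝ) (W : ℝ → E³ → E³) (q : ℝ → E³ → ℝ) (σ : ℝ),
      IsTypeIAncientMild C W → IsClassicalNSSolutionOn (Iio 0) 1 0 W q → σ < 0 →
      ‖curl (W σ) 0‖ = 1 → (∀ s < 0, ∀ y : E³, (-s) * ‖curl (W s) y‖ ≤ -σ) →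
      iteratedFDeriv ℝ 2 (q σ) 0 ![curl (W σ) 0, curl (W σ) 0] <
        κ * ‖curl (W σ) 0‖ ^ 2 * Laplacian.laplacian (q σ) 0 := by
  intro κ hκ C W q σ hW hWq hσ hω1 hapex
  exfalso
  have hzero : ∀ x, W σ x = 0 := hL C W (isTypeIAncientMild_iff.1 hW) σ hσ
  have hWσ : W σ = fun _ => (0 : E³) := funext hzero
  have : ‖curl (W σ) 0‖ = 0 := by rw [hWσ, curl_fun_zero, norm_zero]
  rw [this] at hω1
  exact zero_ne_one hω1

/-! ### Calibration (proved): the Type-I form K1_I of the crux and the two directions -/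

/-- The Type-I / maximal form of the crux (IDEATION-r2-k4 `K1I`, TRIAGE-r2-2 `transfer`,
`K1I_of_crux` kernel-checked there): a maximal Type-I Leray–Hopf solution from a rapidly decaying
datum cannot satisfy the blob hypothesis. -/
def BlobTypeIExclusion : Prop :=
  ∀ (ν T : ℝ), 0 < ν → 0 < T → ∀ (u : ℝ → E³ → E³) (p : ℝ → E³ → ℝ),
    IsMaximalSmoothSolution ν 0 u p T → IsLerayHopfOn T ν 0 (u 0) u →
    HasRapidSpatialDecay (u 0) → IsTypeIBlowup u T →
    ¬ ∃ κ : ℝ, 0 < κ ∧ ∃ Ω : ℝ → ℝ, ∃ t₀ ∈ Set.Ico 0 T, ∀ t ∈ Set.Ico t₀ T,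
      (∃ x : E³, Ω t < ‖curl (u t) x‖) ∧ ∀ x : E³, Ω t < ‖curl (u t) x‖ →
        κ * ‖curl (u t) x‖ ^ 2 * Laplacian.laplacian (p t) x ≤
          iteratedFDeriv ℝ 2 (p t) x ![curl (u t) x, curl (u t) x]

/-- K1 ⇒ K1_I (the Type-I form is formally WEAKER than the crux). -/
theorem blobTypeIExclusion_of_crux (hB : IsobarTomography.BlobRiccatiClosure) :
    BlobTypeIExclusion := by
  intro ν T hν hT u p hmax hLH hdec _hI hblob
  exact hmax.2 (hB ν T hν hT u p hmax.1 hLH hdec hblob)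

/-- `NoTypeII ∧ K1_I ⇒ K1` (the re-base the route's `closes` already performs). -/
theorem crux_of_noTypeII_of_blobTypeIExclusion (hII : IsobarTomography.NoTypeII)
    (hI : BlobTypeIExclusion) : IsobarTomography.BlobRiccatiClosure := by
  intro ν T hν hT u p hcl hLH hdec hblob
  by_contra hext
  have hmax : IsMaximalSmoothSolution ν 0 u p T := ⟨hcl, hext⟩
  exact hI ν T hν hT u p hmax hLH hdec (hII ν T hν hT u p hmax hLH hdec) hblob

/-- B ∧ C ⇒ K1_I (the Type-I content of the line, stated separately for the record). -/
theorem blobTypeIExclusion_of_stubs : BlobTypeIExclusion := by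
  intro ν T hν hT u p hmax hLH hdec hI hblob
  obtain ⟨κ, hκ, Ω, t₀, ht₀, hH⟩ := hblob
  obtain ⟨C, W, q, σ, hW, hWq, hσ, hω1, hapex, hblobW⟩ :=
    stub_apexZoom ν T hν hT u p hmax hLH hdec hI κ Ω t₀ hκ ht₀ hH
  exact absurd hblobW (not_le.2 (stub_apexAntiBlob κ hκ C W q σ hW hWq hσ hω1 hapex))

/-! ### Composition -/

/-- COMPOSITION of the line `type-i-apex-liouville`: the stubs imply the crux
`IsobarTomography.BlobRiccatiClosure` (by name). Not extendable ⇒ maximal ⇒ Type I (stub A,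
the route's shared `NoTypeII`) ⇒ an extremal-apex Type-I ancient profile carrying the blob mark
(stub B) ⇒ contradiction with the apex anti-blob Liouville statement (stub C). -/
theorem BlobRiccatiClosure_of :
    Summit.NavierStokesRegularity.NavierStokesRegularity.Theses.IsobarTomography.BlobRiccatiClosure :=
  crux_of_noTypeII_of_blobTypeIExclusion stub_noTypeII blobTypeIExclusion_of_stubs

end Summit.NavierStokesRegularity.NavierStokesRegularity.Cruxes.BlobRiccatiClosure.TypeIApexLiouville

end
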